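import Literature.NumberTheory.DiophantineApproximation.FactorialRatioRate
import Mathlib.Analysis.SpecialFunctions.Stirling
import Mathlib.Analysis.Asymptotics.Lemmas
import HarnessLib

/-!
# Exponential rate of the factorial ratio `(wn)!^(w+1) / (((w+1)n+1)!)^w`

Topic `Literature/NumberTheory/DiophantineApproximation`. Everything in this file is PROVED.

For a weight `w ≥ 1`, the quantity `R(wn) = (wn)!^(w+1) / (((w+1)n+1)!)^w` is the first
non-vanishing coefficient of the type-I Hermite–Padé forms used for the linear independence of
`1, Li₁(1/N), …, Li_w(1/N)`; its exponential decay rate enters the threshold `N₀(w)` of that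
result. We prove the sharp rate: for every `ε > 0`,

  `exp (-(w (w+1) log ((w+1)/w) + ε) n) ≤ (wn)!^(w+1) / (((w+1)n+1)!)^w`  for all large `n`

(`eventually_exp_le_factorial_pow_ratio`), i.e. the rate is `κ_w = w (w+1) log (1 + 1/w)`
(`κ_1 = 2 log 2`, `κ_2 = 6 log (3/2)`, …). The case `w = 2` is
`eventually_exp_le_factorial_ratio` in `FactorialRatioRate`.

Proof: Stirling's formula via Mathlib, exactly as in the case `w = 2`. The lower bound
`a log a - a ≤ log a!` (`a ≥ 1`) is `Stirling.le_log_factorial_stirling` (dropping non-negative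
terms); the upper bound `log b! ≤ b log b - b + (log b)/2 + 1` for `b ≥ 1` is
`log_factorial_succ_le`. With `a = wn`, `b = (w+1)n + 1` this gives
`log ((wn)!^(w+1) / b!^w) ≥ w(w+1) n (log a - log b) - (3w/2) log b`, and
`log b - log a - log ((w+1)/w) = log (1 + 1/((w+1)n)) ≤ 1/((w+1)n)` bounds the first term below by
`-w(w+1) n log ((w+1)/w) - w`; finally `w + 2w log ((w+1)n+1) ≤ ε n` eventually (`log = o(id)`).

What is NOT here: the matching upper bound (the rate is exact), and any effective threshold.
-/

namespace Literature.NumberTheory.DiophantineApproximation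

open _root_.Filter _root_.Topology _root_.Asymptotics Real

/-- **Exponential rate of `(wn)!^(w+1) / (((w+1)n+1)!)^w` (sharp form, every weight).** For every
weight `w ≥ 1` and every `ε > 0`, eventually in `n`,
`exp (-(w(w+1) log ((w+1)/w) + ε) n) ≤ (wn)!^(w+1) / (((w+1)n+1)!)^w`. This is the decay rate of
the leading coefficient of the Hermite–Padé forms for `1, Li₁, …, Li_w`; it follows from Stirling's
formula (`Stirling.le_log_factorial_stirling`, `log_factorial_succ_le`) and `log x = o(x)`.
[folklore] -/
theorem eventually_exp_le_factorial_pow_ratio (w : ℕ) (hw : 1 ≤ w) {ε : ℝ} (hε : 0 < ε) :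
    ∀ᶠ n : ℕ in Filter.atTop,
      Real.exp (-(((w : ℝ) * (w + 1) * Real.log ((w + 1 : ℝ) / w) + ε) * n)) ≤
        (((w * n).factorial : ℝ) ^ (w + 1)) / ((((w + 1) * n + 1).factorial : ℝ) ^ w) := by
  have hw0 : (0 : ℝ) < w := Nat.cast_pos.mpr (by omega)
  have hw1 : (1 : ℝ) ≤ w := by exact_mod_cast hw
  -- (1) the sub-linear loss `w + 2w log ((w+1)n+1)` is eventually at most `ε n`
  have hlog : ∀ᶠ n : ℕ in atTop,
      (w : ℝ) + 2 * w * Real.log ((w + 1) * (n : ℝ) + 1) ≤ ε * n := by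
    have h1 : ∀ᶠ n : ℕ in atTop, ‖Real.log (n : ℝ)‖ ≤ ε / (4 * w) * ‖id (n : ℝ)‖ :=
      Real.isLittleO_log_id_atTop.natCast_atTop.bound (by positivity)
    have h2 : ∀ᶠ n : ℕ in atTop, (2 * w + 4 * w * Real.log (w + 2)) / ε ≤ (n : ℝ) :=
      tendsto_natCast_atTop_atTop.eventually_ge_atTop _
    filter_upwards [h1, h2, eventually_ge_atTop 1] with n hn1 hn2 hn3
    have hn : (1 : ℝ) ≤ n := by exact_mod_cast hn3
    rw [id, Real.norm_eq_abs, Real.norm_eq_abs, abs_of_nonneg (Real.log_nonneg hn),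
      abs_of_nonneg (zero_le_one.trans hn)] at hn1
    have h3 : 2 * w * Real.log n ≤ ε / 2 * n := by
      have h := mul_le_mul_of_nonneg_left hn1 (by positivity : (0 : ℝ) ≤ 2 * w)
      have e : 2 * (w : ℝ) * (ε / (4 * w) * n) = ε / 2 * n := by
        field_simp
        ring
      linarith
    have h4 : Real.log ((w + 1) * (n : ℝ) + 1) ≤ Real.log (w + 2) + Real.log n := by
      rw [← Real.log_mul (by positivity) (by positivity)]
      exact Real.log_le_log (by positivity) (by linarith)
    have h5 : 2 * w + 4 * w * Real.log (w + 2) ≤ (n : ℝ) * ε := (div_le_iff₀ hε).mp hn2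
    have h6 : 2 * w * Real.log ((w + 1) * (n : ℝ) + 1) ≤
        2 * w * (Real.log (w + 2) + Real.log n) :=
      mul_le_mul_of_nonneg_left h4 (by positivity)
    linarith
  -- (2) the main estimate, for `n ≥ 1` with (1)
  filter_upwards [hlog, eventually_ge_atTop 1] with n hn hn1
  have hn0 : (1 : ℝ) ≤ n := by exact_mod_cast hn1
  have hwn : (1 : ℝ) ≤ w * n := one_le_mul_of_one_le_of_one_le hw1 hn0
  -- Stirling from below for `(wn)!`
  have hA : (w : ℝ) * n * Real.log (w * n) - w * n ≤ Real.log ((w * n).factorial : ℝ) := by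
    have h := Stirling.le_log_factorial_stirling (n := w * n) (by positivity)
    push_cast at h
    have h1 : 0 ≤ Real.log (w * n) := Real.log_nonneg hwn
    have h2 : 0 ≤ Real.log (2 * π) := Real.log_nonneg (by linarith [Real.two_le_pi])
    linarith
  -- Stirling from above for `((w+1)n+1)!`
  have hB : Real.log (((w + 1) * n + 1).factorial : ℝ) ≤
      ((w + 1) * n + 1) * Real.log ((w + 1) * n + 1) - ((w + 1) * n + 1)
        + Real.log ((w + 1) * n + 1) / 2 + 1 := by
    have h := log_factorial_succ_le ((w + 1) * n)
    push_cast at h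
    exact h
  -- `log ((w+1)n+1) - log (wn) - log ((w+1)/w) = log (1 + 1/((w+1)n)) ≤ 1/((w+1)n)`
  have hkey : Real.log ((w + 1) * n + 1) ≤
      Real.log (w * n) + Real.log ((w + 1) / w) + 1 / ((w + 1) * n) := by
    have h1 : Real.log (((w + 1) * n + 1) / ((w + 1) * n)) ≤
        ((w + 1) * n + 1) / ((w + 1) * n) - 1 :=
      Real.log_le_sub_one_of_pos (by positivity)
    have h2 : Real.log (((w + 1) * n + 1) / ((w + 1) * n)) =
        Real.log ((w + 1) * n + 1) - (Real.log (w * n) + Real.log ((w + 1) / w)) := by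
      have e : (w : ℝ) * n * ((w + 1) / w) = (w + 1) * n := by
        field_simp
      rw [← Real.log_mul (by positivity : (w : ℝ) * n ≠ 0)
          (by positivity : ((w : ℝ) + 1) / w ≠ 0), e,
        Real.log_div (by positivity : ((w : ℝ) + 1) * n + 1 ≠ 0)
          (by positivity : ((w : ℝ) + 1) * n ≠ 0)]
    have h3 : (((w : ℝ) + 1) * n + 1) / ((w + 1) * n) - 1 = 1 / ((w + 1) * n) := by
      field_simp
      ring
    linarith
  -- multiply by `w (w+1) n ≥ 0`: the excess `w (w+1) n / ((w+1) n) = w` is a constant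
  have h6 : (w : ℝ) * (w + 1) * n * Real.log ((w + 1) * n + 1) ≤
      (w : ℝ) * (w + 1) * n * Real.log (w * n)
        + (w : ℝ) * (w + 1) * n * Real.log ((w + 1) / w) + w := by
    have h := mul_le_mul_of_nonneg_left hkey (by positivity : (0 : ℝ) ≤ (w : ℝ) * (w + 1) * n)
    have e : (w : ℝ) * (w + 1) * n * (1 / ((w + 1) * n)) = w := by
      field_simp
    linarith
  -- weighted Stirling bounds
  have hA' : ((w : ℝ) + 1) * (w * n * Real.log (w * n) - w * n) ≤
      (w + 1) * Real.log ((w * n).factorial : ℝ) :=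
    mul_le_mul_of_nonneg_left hA (by positivity)
  have hB' : (w : ℝ) * Real.log (((w + 1) * n + 1).factorial : ℝ) ≤
      w * (((w + 1) * n + 1) * Real.log ((w + 1) * n + 1) - ((w + 1) * n + 1)
        + Real.log ((w + 1) * n + 1) / 2 + 1) :=
    mul_le_mul_of_nonneg_left hB hw0.le
  have hlogb : 0 ≤ (w : ℝ) * Real.log ((w + 1) * n + 1) :=
    mul_nonneg hw0.le (Real.log_nonneg (le_add_of_nonneg_left (by positivity)))
  -- combine in logarithmic form
  have hR : -(((w : ℝ) * (w + 1) * Real.log ((w + 1 : ℝ) / w) + ε) * n) ≤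
      (w + 1) * Real.log ((w * n).factorial : ℝ)
        - w * Real.log (((w + 1) * n + 1).factorial : ℝ) := by
    linarith
  have hApos : (0 : ℝ) < (w * n).factorial := by exact_mod_cast Nat.factorial_pos _
  have hBpos : (0 : ℝ) < ((w + 1) * n + 1).factorial := by exact_mod_cast Nat.factorial_pos _
  rw [← Real.exp_log (by positivity :
      (0 : ℝ) < ((w * n).factorial : ℝ) ^ (w + 1) / (((w + 1) * n + 1).factorial : ℝ) ^ w),
    Real.exp_le_exp, Real.log_div (pow_pos hApos _).ne' (pow_pos hBpos _).ne', Real.log_pow,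
    Real.log_pow]
  push_cast
  linarith

end Literature.NumberTheory.DiophantineApproximation
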